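import Literature.AlgebraicGeometry.Resolution.KangarooAtlasCertWeightedCoord

/-!
# Factorisation classes of stall nodes — computable twin of the observatory's classifier (rows W20, pub-rosobs observatory)

The observatory splits the recorded pair-stalls of the transplanted weighted blow-up (conventions FW1–FW7) by an exact
factorisation test on the node `F ∈ 𝔽_p[u]` (PATTERNS C24[cg3]; Python `criteria/normalform.py`, `normalform2.py`):

  `F = L · E(u_j) · g^p`  with `L = u_j` (or a triangular coordinate `u_j + h(u_{≠ j})` when `F` is linear in `u_j`),
  `E = 1 + c₁ u_j + c₂ u_j²` a unit, `g` a polynomial (Frobenius root over `𝔽_p`),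

and reads the linear part of `g`: class `A` (code `0`: `lin g ∝ u_j`, formally the cusp cylinder `x''^p + v^{p+1}`),
`U` (code `1`: `lin g` involves another variable — in the polynomial étale coordinates `Y = L·E`, `Z = g` the node is the
`p`-umbrella cylinder `x^p + Y Z^p`, whose singular locus is homogeneous in characteristic `p` and is resolved by one
blow-up, `WeightedBlowupUmbrella`; [Kollar2007, Ex. 3.6.1] for Whitney's umbrella), `higher` (code `2`: `lin g = 0`),
`none` (code `3`).  Classes `A`/`U` are point-centre artefacts; `higher`/`none` is the residue the census reports.
This file is the Lean twin of that search (same candidate order), used by the observatory to cross-evaluate the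
classifier on all 490 stall nodes by `#guard`; rows W20 are named instances by `decide +kernel`.  Polynomial arithmetic
`pmul`/`ppow` is atlas-g9's (`KangarooAtlasCertWeightedCoord`).  Data about polynomials; no statement about resolution of
singularities. (derived here) [folklore]
-/

namespace Literature.AlgebraicGeometry.Resolution.KangarooAtlasCertWeighted

open KangarooAtlasCert

set_option Elab.async false

/-- `F / u_j` if `u_j` divides every monomial, else `none`. [folklore] -/
def divVar (j : ℕ) (F : Poly) : Option Poly :=
  if F.all (fun t => t.1.getD j 0 ≥ 1) then some (F.map (fun t => (t.1.set j (t.1.getD j 0 - 1), t.2))) else none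

/-- coefficients `a_0 … a_T` of the inverse power series of `1 + c₁ u + c₂ u²` over `𝔽_p`
(`a_0 = 1`, `a_n = −(c₁ a_{n−1} + c₂ a_{n−2})`). [folklore] -/
def invCoeffs (p c₁ c₂ T : ℕ) : List ℕ :=
  ((List.range T).foldl (fun (acc : List ℕ) _ =>
      match acc with
      | [] => [1 % p]
      | [a] => ((p - (c₁ * a) % p) % p) :: [a]
      | a :: b :: rest => ((2 * p - (c₁ * a) % p - (c₂ * b) % p) % p) :: a :: b :: rest) [1 % p]).reverse

/-- the unit `E = 1 + c₁ u_j + c₂ u_j²` as a `Poly` in `m` variables. [folklore] -/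
def unitPoly (p m j c₁ c₂ : ℕ) : Poly :=
  normalize p [((List.replicate m 0), 1), ((List.replicate m 0).set j 1, c₁), ((List.replicate m 0).set j 2, c₂)]

/-- exact division of `G` by the unit `1 + c₁ u_j + c₂ u_j²` (multiply by the truncated inverse series, truncate at
`deg_{u_j} G`, verify), else `none`. [folklore] -/
def divUnit (p m j c₁ c₂ : ℕ) (G : Poly) : Option Poly :=
  if c₁ % p = 0 ∧ c₂ % p = 0 then some G else
  let T := (G.map (fun t => t.1.getD j 0)).foldl max 0
  let inv : Poly := normalize p (((invCoeffs p c₁ c₂ T).zipIdx).map (fun ac => ((List.replicate m 0).set j ac.2, ac.1)))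
  let H := (pmul p G inv).filter (fun t => t.1.getD j 0 ≤ T)
  if sameTerms (pmul p H (unitPoly p m j c₁ c₂)) (normalize p G) then some H else none

/-- Frobenius root: `some g` with `g^p = H` (over `𝔽_p`, coefficientwise) if every exponent is divisible by `p`. [folklore] -/
def pthRoot (p : ℕ) (H : Poly) : Option Poly :=
  if H.all (fun t => t.1.all (fun e => e % p = 0)) then some (H.map (fun t => (t.1.map (· / p), t.2))) else none

/-- indices of the variables occurring in the linear part of `g`. [folklore] -/
def linVars (g : Poly) : List ℕ :=
  (g.filter (fun t => deg t.1 = 1)).map (fun t => (t.1.zipIdx.find? (fun ei => ei.1 = 1)).elim 0 (fun ei => ei.2))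

/-- class code of `g` relative to `u_j`: `0` = A (`lin g` only `u_j`), `1` = U (another variable occurs), `2` = higher. [folklore] -/
def classOfRoot (j : ℕ) (g : Poly) : ℕ :=
  let lv := linVars g
  if lv.isEmpty then 2 else if lv.all (· = j) then 0 else 1

/-- class found with `L = u_j`: first unit `(c₁, c₂)` in lexicographic order for which `F / u_j / E` is a `p`-th power
(`3` if none; as in `normalform.py`). [folklore] -/
def classVar (p m : ℕ) (F : Poly) (j : ℕ) : ℕ :=
  match divVar j F with
  | none => 3
  | some G =>
    let cands := (List.range p).flatMap (fun c₁ => (List.range p).map (fun c₂ => (c₁, c₂)))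
    match cands.findSome? (fun cc => (divUnit p m j cc.1 cc.2 G).bind (pthRoot p)) with
    | none => 3
    | some g => classOfRoot j g

/-- the base classifier (`normalform.py`): minimum class over the variables. [folklore] -/
def nfClass1 (p : ℕ) (F : Poly) : ℕ :=
  let m := nvars F
  ((List.range m).map (classVar p m (normalize p F))).foldl min 3

/-- the triangular pass of `normalform2.py`: if `F = a_1 · (u_j + h)` with `a_1 = c·u^α u_j` a single term and `h` a
polynomial (exact monomial division), classify `a_1 u_j` (the node in the coordinates `u_j ↦ u_j − h`). [folklore] -/
def classLinear (p : ℕ) (F : Poly) (j : ℕ) : ℕ :=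
  let Fn := normalize p F
  let a1 := Fn.filter (fun t => t.1.getD j 0 = 1)
  let a0 := Fn.filter (fun t => t.1.getD j 0 = 0)
  if Fn.any (fun t => t.1.getD j 0 ≥ 2) then 3 else
  match a1, a0 with
  | [t], (_ :: _) =>
      let α := t.1.set j 0
      if a0.all (fun s => (List.zipWith (fun a b => decide (a ≥ b)) s.1 α).all id ∧ s.1.length = α.length)
      then nfClass1 p [t] else 3
  | _, _ => 3

/-- the widened classifier (`normalform2.py`, exact passes): `min` of the base class and the triangular classes. [folklore] -/
def nfClass (p : ℕ) (F : Poly) : ℕ :=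
  let m := nvars F
  ((List.range m).map (classLinear p F)).foldl min (nfClass1 p F)

section Rows

/-- (W20a) Whitney–Włodarczyk umbrella node `u_0² u_1` (`𝔽_2`, variables `(y,z)` of `x² + y²z`): class U (`1`);
Moh's `u_0 u_1⁶ + u_0⁵ u_1³` (`𝔽_3`): none (`3`); the dimension-4 node `u_0² u_1 u_2²` (`𝔽_2`): higher (`2`);
type A `u_1³ + u_1⁵ + u_1⁷ + u_1 u_2⁸` (`𝔽_2`, variables `(s,u_1,u_2)`): A (`0`). (derived here) [folklore] -/
theorem nfClass_w20a :
    nfClass 2 [([2, 1], 1)] = 1 ∧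
    nfClass 3 [([1, 6], 1), ([5, 3], 1)] = 3 ∧
    nfClass 2 [([2, 1, 2], 1)] = 2 ∧
    nfClass 2 [([0, 3, 0], 1), ([0, 5, 0], 1), ([0, 7, 0], 1), ([0, 1, 8], 1)] = 0 := by
  decide +kernel

/-- (W20b) the triangular pass: `u_0 u_1² + u_1⁵ = (u_0 + u_1³)·u_1²` over `𝔽_2` (node `bin-p2-y1z2-y4-z5`, i.e.
`x² + yz² + y⁴ + z⁵` after cleaning) is class U (`1`) for `nfClass` but none (`3`) for the base classifier `nfClass1`;
the Bérczi A4 node `2u_2³u_3 + u_2³u_3² = u_3(1 + 2u_3)(2u_2)³` over `𝔽_3` is class U with the unit `E = 1 + 2u_3`;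
the trinomial tail `u_0 u_1² + u_1⁵ + u_0⁵` (`x² + yz² + y⁵ + z⁵`, `𝔽_2`, isolated singular point) is none. (derived here) [folklore] -/
theorem nfClass_w20b :
    nfClass 2 [([1, 2], 1), ([0, 5], 1)] = 1 ∧ nfClass1 2 [([1, 2], 1), ([0, 5], 1)] = 3 ∧
    nfClass 3 [([0, 0, 3, 1], 2), ([0, 0, 3, 2], 1)] = 1 ∧
    nfClass 2 [([1, 2], 1), ([0, 5], 1), ([5, 0], 1)] = 3 := by
  decide +kernel

end Rows

end Literature.AlgebraicGeometry.Resolution.KangarooAtlasCertWeighted
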